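import Summits.QuantumFields.YangMills.Theorems.BalabanUVNodesN19MGFKernelTowerMGF
import Summits.QuantumFields.BalabanUV.T4Continuum.Spine.NE1p.DressedMGFForm
import Literature.MathematicalPhysics.QuantumFieldTheory.Balaban1983to89.Node00.Record12MeasurabilityAtRecord
import Literature.MathematicalPhysics.QuantumFieldTheory.Balaban1983to89.Node00.Record13LiveSelector
import Summits.QuantumFields.YangMills.Theorems.BalabanUVNodesN19MGFRoadLiveSelectorTower

/-!
# Route `BalabanUVNodes`, node N19 (NE7), lens ROW MF-ID AT THE RECORD — `MGFForm` OF NODE 00's DRESSED CLASS WEIGHTS AT THE IDENTITY SELECTOR: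
# F3's `classWeightOfDatum₉ ϑ D g₀ os p g k t s` IS `mgf (prodObs (D.scheme g₀) p.K os) ν t` for ALL `t`, with the class
# measure `ν = classMeasureOfSlots … (wOfRecord₉ ϑ) p g (boltzmann) k s` EXPLICIT, t-FREE and FINITE — hence `DressedMGFForm.MGFForm 1 T F ν A` for every
# K-indexed reading of these weights (`Bo = 1`)

Cell `pub-ymgap`, YM-PLAN Track A (HUMAN RULING D-0062), seat `pub-ymgap-dag-n19-d` (g6), lens decomp v5 ROW MF-ID, dag-lead REBALANCE №65 (c) «the AT-RECORD
module» (WORDS-125∕126∕131∕132; generic kernel chain = dag-n19-e `…N19MGFFormKernelChain(RStep)`, GUARD⁻ = dag-n19-c `…N19VacuumK5MGFRoadNoGo`, live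
selector = dag-n19-c OFFER-21).  Filing `--kind proof --supports stmt-QuantumFields-19912 --as helper` (K3‴ `SpineGivenEndpointR13`; count-neutral).  Consumes
module A `…N19MGFKernelTower(MGF)` (the measure-valued kernel dual of def-T's recursion, parts 1–2) BY NAME.  [III] = [Balaban1988Convergent], [IV] = [Balaban1989LargeFieldI].

ROW K14-β, ONE SENTENCE (lens decomp v5 §1–§3, to be read with every file of the N19 vacuum-MGF road): **`MGFForm` at a reading built from F3
`Node00.dressedSlotsOfDatum₉` HOLDS at the selectors of record (`ppSelIdOfRecord` — this file —, `ppSelLiveOfRecord` — the live-selector layer: 𝐑 is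
a t-free `{0,1}`-multiplier) and FAILS in general at a contentful selector unless the dressed tower is re-typed in convention (α) (lens v5 §1–§2;
dag-n19-c `…N19VacuumK5MGFRoadNoGo.two_mul_mgf_zero_le` ∕ `toyB_not_mgfForm`).**

WHAT IS PROVED (bookkeeping; every estimate-free).
* §1 THE CLASS MEASURE ν of one sequence of record at level `k` is module A's `classMeasureOfSlots` AT F3's step weights `wOfRecord₉ ϑ` and the Boltzmann
  reference start `e^{−A∕g₀(K)²}` — written EXPLICITLY in every statement (no new `def`: this file is theorems-only), on the ORIGINAL field space
  `GaugeField (F.P p.K) 0 (SU N)`, independent of `D`, `os`, `t` (the observable enters the start only through the dressing) — N14's NOTE N14-ν object;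
  `isFiniteMeasure_classMeasure_dressedSlotsOfDatum₉`.
* §2 ★ `classWeightOfDatum₉_eq_mgf_of_ppSelId`: at a Stage-9 tuple whose `p–p′` selector is the IDENTITY (`ϑ.ppSel = ppSelIdOfRecord`), under the
  DISPLAYED laws of the residual step-weight data (`0 ≤ w ≤ 1`, joint measurability; measurable `χ_k`) and `D.AvgMeasurable`:
  `classWeightOfDatum₉ ϑ D g₀ os p g k t s = mgf (prodObs (D.scheme g₀) p.K os) (classMeasureOfSlots … (wOfRecord₉ ϑ) p g (boltzmann …) k s) t` — ALL `t k s`; the `t = 0` face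
  `classWeightOfDatum₉_zero_eq_measureReal`.  ★ `mgfForm_classWeightOfDatum₉_of_ppSelId`: `DressedMGFForm.MGFForm 1 T (K ↦ prodObs …) ν A` for ANY
  K-indexed keys `pK, gK, kK` and ANY decoding `e K : ι → SeqOfRecord …` a spine-carrier reading uses — `Bo = 1`.
* §3 the displayed laws DISCHARGED from NODE 00's rows: `0 ≤ w ≤ 1` from `0 ≤ ζ` + `IsZetaAbsLeOne` (`Record9InhabitedSU1.wOfRecord_nonneg`, `abs_wOfRecord_le_one`),
  measurability from (H-U) `LocalBgMeasurable` + (H-ζ) `ZetaMeasurable` (`Record12Measurability`): `classWeightOfDatum₉_eq_mgf_of_localBg` ∕ `mgfForm_…_of_localBg`;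
  and AT THE K0′ WITNESS `θ₀ = theta12OfRecord F N (zeta316OfRecord F N numerics7OfRecord₁₂ 1 1) Rz Zt` (identity selector by `theta12OfRecord_ppSel`, ζ-laws by
  K0b's `zeta316OfRecord_nonneg` ∕ `isZetaAbsLeOne_zeta316OfRecord` ∕ `zetaMeasurable_zeta316OfRecord_of_localBg`): `classWeightOfDatum₉_eq_mgf_theta12OfRecord`,
  `mgfForm_classWeightOfDatum₉_theta12OfRecord` — ONE displayed hypothesis left, (H-U).  The ₁₃ witness of record `theta13LiveOfRecord` carries the LIVE
  selector: its face is the live-selector layer's (dag-n19-c OFFER-21), on top of module A.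
* §4 the Kernel BRIDGE for the generic chain files (dag-n19-e `…KernelChainMeasureStart`): `exists_kernel_eq_slotMeasure` — module A's `slotMeasure` at F3's
  data IS (the coercion of) a Mathlib `Kernel` whose level-0 value is the measure-valued start `ofReal(boltzmann U) • dirac U` (their `hK0`).

HONEST FRAMING — what this is NOT.  [folklore ∕ bookkeeping] on NODE 00's typed objects; it discharges the SHAPE `MGFForm` that `…N19VacuumMGFRoad` :228∕:325
and `…N19VacuumK5MGFRoad` :90∕:109 display — AT THE IDENTITY SELECTOR and modulo the displayed (H-U) row of K0′; it does NOT build the spine-carrier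
reading `cr` from F3 (Summits-side, not in the tree), is NOT valid at a contentful selector (ROW K14-β), proves NO estimate (NE7 ∕ NE1′ ∕ `TiltedMeanMatching`
untouched); nothing of Bałaban's is instantiated; N19 NOT discharged (0∕1); K3‴ NOT claimed; counts UNMOVED (typed 28∕28 · discharged 5∕27).  One finite
four-torus programme at fixed `ε` — NOT ℝ⁴, NOT infinite volume, NOT OS, NOT a mass gap, NOT the Clay problem.  No `sorry`, no `axiom`, no `instance`,
no `notation`, no `def` (theorems only).
-/

noncomputable section

namespace Summit.QuantumFields.YangMills.BalabanUVNodes.N19MGFFormAtRecord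

open MeasureTheory ProbabilityTheory
open scoped ENNReal Matrix.Norms.L2Operator
open Literature.MathematicalPhysics.QuantumFieldTheory.Balaban1983to89
open Literature.MathematicalPhysics.QuantumFieldTheory.Balaban1983to89.Node00
open T4Continuum B14.Eq218Concrete
open Summit.QuantumFields.YangMills.BalabanUVNodes.N19MGFKernelTower
open Summit.QuantumFields.BalabanUV.T4Continuum.NE1p.DressedMGFForm (MGFForm)

variable {F : T4Family} {N : ℕ} [NeZero N]

/-! ## §1 The class measure of a sequence of record (module A's `classMeasureOfSlots` at F3's data) is finite -/

/-- The dressed start of F3 IS the exponential dressing of the Boltzmann reference start (`rfl`). [cite: King1986, (3.10) p.656 (bookkeeping)] -/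
theorem dressedStart_apply (D : FiniteEpsData F (SU N)) (g₀ : ℕ → ℝ) (os : List (ULoop F)) (t : ℝ) (p : B12.RunParams) (g : ℕ → ℝ)
    (U : GaugeField (F.P p.K) 0 (SU N)) :
    (fun (p : B12.RunParams) (_ : ℕ → ℝ) => dressedStart F N D g₀ os t p) p g U =
      Real.exp (t * T4GenFunBounds.prodObs (D.scheme g₀) p.K os U) * Missing.boltzmann (F.P p.K) ((g₀ p.K)⁻¹ ^ 2) U := rfl

/-- **THE CLASS MEASURES ARE FINITE** (mass ≤ `∫ e^{−A∕g₀²} dU₀ < ∞`: module A's mass bound; displayed laws `w ≤ 1`, joint measurability of `w`, measurable `χ_k`).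
[cite: Balaban1988Convergent, (2.18) p.257 (bookkeeping)] -/
theorem isFiniteMeasure_classMeasure_dressedSlotsOfDatum₉ (ϑ : Stage9Params F N) {p : B12.RunParams} {g : ℕ → ℝ}
    (hw1 : ∀ k s' U V', wOfRecord₉ F N ϑ p g k s' U V' ≤ 1)
    (hwm : ∀ k s', Measurable fun z : GaugeField (F.P p.K) (k + 1) (SU N) × GaugeField (F.P p.K) k (SU N) => wOfRecord₉ F N ϑ p g k s' z.2 z.1)
    (hχm : ∀ k s, Measurable (chiSeqOfRecord F N ϑ.ν ϑ.τ9.M g p.K k s)) (g₀ : ℕ → ℝ) (k : ℕ) (s : SeqOfRecord F ϑ.ν ϑ.τ9.M g p.K k) :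
    IsFiniteMeasure (classMeasureOfSlots F N ϑ.ν ϑ.τ9 (wOfRecord₉ F N ϑ) p g (Missing.boltzmann (F.P p.K) ((g₀ p.K)⁻¹ ^ 2)) k s) :=
  isFiniteMeasure_classMeasureOfSlots hw1 hwm hχm (Missing.measurable_boltzmann RegularGaugeGroup.measurable_reTr (F.P p.K) _)
    (Missing.integrable_boltzmann RegularGaugeGroup.measurable_reTr (F.P p.K) (sq_nonneg _)).lintegral_lt_top k s

/-! ## §2 ★ The class weight IS a moment generating function (identity selector), and the `MGFForm` packaging -/

/-- **★ F3's DRESSED CLASS WEIGHT IS AN MGF — AT THE IDENTITY SELECTOR, ALL `t`.**  For a Stage-9 tuple `ϑ` with `ϑ.ppSel = ppSelIdOfRecord`, under the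
DISPLAYED laws of the residual step weights (`0 ≤ wOfRecord₉ ϑ`, jointly measurable) and measurable `χ_k`, and for a datum with measurable averaging maps:
`classWeightOfDatum₉ ϑ D g₀ os p g k t s = mgf (prodObs (D.scheme g₀) p.K os) (classMeasureOfSlots … (wOfRecord₉ ϑ) p g (boltzmann …) k s) t` — module A's kernel representation at
F3's `dressedSlotsOfDatum₉` (start `e^{t·prodObs}·boltzmann`, `|prodObs| ≤ 1`). [cite: King1986, (3.10) p.656; Balaban1988Convergent, (2.18) p.257; Balaban1989LargeFieldI, (0.3) p.176 (bookkeeping)] -/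
theorem classWeightOfDatum₉_eq_mgf_of_ppSelId (ϑ : Stage9Params F N) (hsel : ϑ.ppSel = ppSelIdOfRecord F ϑ.ν ϑ.τ9.M) {p : B12.RunParams} {g : ℕ → ℝ}
    (hw0 : ∀ k s' U V', 0 ≤ wOfRecord₉ F N ϑ p g k s' U V')
    (hwm : ∀ k s', Measurable fun z : GaugeField (F.P p.K) (k + 1) (SU N) × GaugeField (F.P p.K) k (SU N) => wOfRecord₉ F N ϑ p g k s' z.2 z.1)
    (hχm : ∀ k s, Measurable (chiSeqOfRecord F N ϑ.ν ϑ.τ9.M g p.K k s)) (D : FiniteEpsData F (SU N)) (hD : D.AvgMeasurable)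
    (g₀ : ℕ → ℝ) (os : List (ULoop F)) (k : ℕ) (t : ℝ) (s : SeqOfRecord F ϑ.ν ϑ.τ9.M g p.K k) :
    classWeightOfDatum₉ F N ϑ D g₀ os p g k t s =
      mgf (T4GenFunBounds.prodObs (D.scheme g₀) p.K os)
        (classMeasureOfSlots F N ϑ.ν ϑ.τ9 (wOfRecord₉ F N ϑ) p g (Missing.boltzmann (F.P p.K) ((g₀ p.K)⁻¹ ^ 2)) k s) t := by
  have hsel' : ∀ (k : ℕ) (s : SeqOfRecord F ϑ.ν ϑ.τ9.M g p.K (k + 1)), ϑ.ppSel p g (k + 1) s = s := fun k s => by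
    rw [hsel]; rfl
  exact integral_chi_mul_texpAOfRecordFrom_eq_mgf hsel' hw0 hwm hχm
    (Missing.measurable_boltzmann RegularGaugeGroup.measurable_reTr (F.P p.K) _) (fun U => (Missing.boltzmann_pos (F.P p.K) _ U).le)
    (T4GenFunBounds.measurable_prodObs (D.scheme g₀) (fun K o => D.measurable_avgObs hD K o) p.K os)
    (T4GenFunBounds.abs_prodObs_le_one (D.scheme g₀) (fun K o U => D.abs_avgObs_le_one K o U) p.K os) t (fun _ => rfl) k s

/-- **The `t = 0` face**: the UNDRESSED class weight is the MASS of the class measure. [cite: Balaban1988Convergent, (2.18) p.257 (bookkeeping)] -/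
theorem classWeightOfDatum₉_zero_eq_measureReal (ϑ : Stage9Params F N) (hsel : ϑ.ppSel = ppSelIdOfRecord F ϑ.ν ϑ.τ9.M) {p : B12.RunParams} {g : ℕ → ℝ}
    (hw0 : ∀ k s' U V', 0 ≤ wOfRecord₉ F N ϑ p g k s' U V')
    (hwm : ∀ k s', Measurable fun z : GaugeField (F.P p.K) (k + 1) (SU N) × GaugeField (F.P p.K) k (SU N) => wOfRecord₉ F N ϑ p g k s' z.2 z.1)
    (hχm : ∀ k s, Measurable (chiSeqOfRecord F N ϑ.ν ϑ.τ9.M g p.K k s)) (D : FiniteEpsData F (SU N)) (hD : D.AvgMeasurable)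
    (g₀ : ℕ → ℝ) (os : List (ULoop F)) (k : ℕ) (s : SeqOfRecord F ϑ.ν ϑ.τ9.M g p.K k) :
    classWeightOfDatum₉ F N ϑ D g₀ os p g k 0 s =
      (classMeasureOfSlots F N ϑ.ν ϑ.τ9 (wOfRecord₉ F N ϑ) p g (Missing.boltzmann (F.P p.K) ((g₀ p.K)⁻¹ ^ 2)) k s).real Set.univ := by
  rw [classWeightOfDatum₉_eq_mgf_of_ppSelId ϑ hsel hw0 hwm hχm D hD g₀ os k 0 s]
  exact mgf_zero'

/-- **★ `MGFForm` FOR F3's DRESSED CLASS WEIGHTS AT THE IDENTITY SELECTOR** — the displayed hypothesis of the N19 vacuum-MGF road, DISCHARGED IN SHAPE for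
any reading that decodes its class index into sequences of record: run-indexed keys `pK K, gK K, kK K`, classes `T K : Finset ι`, decoding `e K : ι → SeqOfRecord …`;
observable `prodObs (D.scheme g₀) (pK K).K os` on the original field space, `Bo = 1`, class measures `classMeasureOfSlots …` EXPLICIT. [cite: King1986, (3.10) p.656; Balaban1989LargeFieldI, (0.3) p.176 (bookkeeping)] -/
theorem mgfForm_classWeightOfDatum₉_of_ppSelId {ι : Type*} (ϑ : Stage9Params F N) (hsel : ϑ.ppSel = ppSelIdOfRecord F ϑ.ν ϑ.τ9.M)
    (hw0 : ∀ p g k s' U V', 0 ≤ wOfRecord₉ F N ϑ p g k s' U V') (hw1 : ∀ p g k s' U V', wOfRecord₉ F N ϑ p g k s' U V' ≤ 1)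
    (hwm : ∀ (p : B12.RunParams) (g : ℕ → ℝ) k s',
      Measurable fun z : GaugeField (F.P p.K) (k + 1) (SU N) × GaugeField (F.P p.K) k (SU N) => wOfRecord₉ F N ϑ p g k s' z.2 z.1)
    (hχm : ∀ (p : B12.RunParams) (g : ℕ → ℝ) k s, Measurable (chiSeqOfRecord F N ϑ.ν ϑ.τ9.M g p.K k s))
    (D : FiniteEpsData F (SU N)) (hD : D.AvgMeasurable) (g₀ : ℕ → ℝ) (os : List (ULoop F))
    (pK : ℕ → B12.RunParams) (gK : ℕ → ℕ → ℝ) (kK : ℕ → ℕ) (T : ℕ → Finset ι)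
    (e : ∀ K, ι → SeqOfRecord F ϑ.ν ϑ.τ9.M (gK K) (pK K).K (kK K)) :
    MGFForm 1 T (fun K => T4GenFunBounds.prodObs (D.scheme g₀) (pK K).K os)
      (fun K τ => classMeasureOfSlots F N ϑ.ν ϑ.τ9 (wOfRecord₉ F N ϑ) (pK K) (gK K) (Missing.boltzmann (F.P (pK K).K) ((g₀ (pK K).K)⁻¹ ^ 2))
        (kK K) (e K τ))
      (fun K t τ => classWeightOfDatum₉ F N ϑ D g₀ os (pK K) (gK K) (kK K) t (e K τ)) where
  nonneg := zero_le_one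
  meas K := T4GenFunBounds.measurable_prodObs (D.scheme g₀) (fun K o => D.measurable_avgObs hD K o) (pK K).K os
  bound K ω := T4GenFunBounds.abs_prodObs_le_one (D.scheme g₀) (fun K o U => D.abs_avgObs_le_one K o U) (pK K).K os ω
  finite K τ _ := isFiniteMeasure_classMeasure_dressedSlotsOfDatum₉ ϑ (hw1 _ _) (hwm _ _) (hχm _ _) g₀ (kK K) (e K τ)
  repr K t τ _ := classWeightOfDatum₉_eq_mgf_of_ppSelId ϑ hsel (hw0 _ _) (hwm _ _) (hχm _ _) D hD g₀ os (kK K) t (e K τ)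

/-! ## §3 The displayed laws discharged from NODE 00's rows; the K0′ witness `θ₀` -/

/-- `0 ≤ wOfRecord₉ ϑ` from a non-negative residual fluctuation factor `ϑ.ζ` (`Record9InhabitedSU1.wOfRecord_nonneg`). [cite: Balaban1988Convergent, (3.2)–(3.5) p.265, (3.16) p.268 (bookkeeping)] -/
theorem wOfRecord₉_nonneg (ϑ : Stage9Params F N) (hζ0 : ∀ p g k s Pl Ql RS U V', 0 ≤ ϑ.ζ p g k s Pl Ql RS U V') (p : B12.RunParams) (g : ℕ → ℝ)
    (k : ℕ) (s' : SeqOfRecord F ϑ.ν ϑ.τ9.M g p.K (k + 1)) (U : GaugeField (F.P p.K) k (SU N)) (V' : GaugeField (F.P p.K) (k + 1) (SU N)) :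
    0 ≤ wOfRecord₉ F N ϑ p g k s' U V' :=
  wOfRecord_nonneg F N ϑ.ν ϑ.τ9.M p g k ϑ.A₁ hζ0 s' U V'

/-- `wOfRecord₉ ϑ ≤ 1` from the displayed ζ-size law `IsZetaAbsLeOne` (`abs_wOfRecord_le_one`). [cite: Balaban1988Convergent, (3.2)–(3.3) p.265 (bookkeeping)] -/
theorem wOfRecord₉_le_one (ϑ : Stage9Params F N) (hζ1 : IsZetaAbsLeOne F N ϑ.ν ϑ.τ9.M ϑ.ζ) (p : B12.RunParams) (g : ℕ → ℝ) (k : ℕ)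
    (s' : SeqOfRecord F ϑ.ν ϑ.τ9.M g p.K (k + 1)) (U : GaugeField (F.P p.K) k (SU N)) (V' : GaugeField (F.P p.K) (k + 1) (SU N)) :
    wOfRecord₉ F N ϑ p g k s' U V' ≤ 1 :=
  (le_abs_self _).trans (abs_wOfRecord_le_one F N ϑ.ν ϑ.τ9.M ϑ.A₁ hζ1 p g k s' U V')

/-- **★ THE MGF IDENTITY WITH THE LAWS DISCHARGED FROM (H-U) ∕ (H-ζ) ∕ `0 ≤ ζ`**: identity selector, local backgrounds measurable (`LocalBgMeasurable`, K0′ row (H-U)),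
residual fluctuation factor jointly measurable and non-negative. [cite: King1986, (3.10) p.656; Balaban1988Convergent, (2.18) p.257, (3.16) p.268 (bookkeeping)] -/
theorem classWeightOfDatum₉_eq_mgf_of_localBg (ϑ : Stage9Params F N) (hsel : ϑ.ppSel = ppSelIdOfRecord F ϑ.ν ϑ.τ9.M)
    (hU : LocalBgMeasurable F N ϑ.ν) (hζm : ZetaMeasurable F N ϑ.ζ) (hζ0 : ∀ p g k s Pl Ql RS U V', 0 ≤ ϑ.ζ p g k s Pl Ql RS U V')
    (D : FiniteEpsData F (SU N)) (hD : D.AvgMeasurable) (g₀ : ℕ → ℝ) (os : List (ULoop F)) (p : B12.RunParams) (g : ℕ → ℝ) (k : ℕ) (t : ℝ)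
    (s : SeqOfRecord F ϑ.ν ϑ.τ9.M g p.K k) :
    classWeightOfDatum₉ F N ϑ D g₀ os p g k t s =
      mgf (T4GenFunBounds.prodObs (D.scheme g₀) p.K os)
        (classMeasureOfSlots F N ϑ.ν ϑ.τ9 (wOfRecord₉ F N ϑ) p g (Missing.boltzmann (F.P p.K) ((g₀ p.K)⁻¹ ^ 2)) k s) t :=
  classWeightOfDatum₉_eq_mgf_of_ppSelId ϑ hsel (wOfRecord₉_nonneg ϑ hζ0 p g)
    (fun k s' => measurable_wOfRecord_of_localBg hU ϑ.τ9.M ϑ.A₁ hζm p g k s')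
    (fun k s => measurable_chiSeqOfRecord_of_localBg hU ϑ.τ9.M g p.K k s) D hD g₀ os k t s

/-- **★ `MGFForm` with the laws discharged from (H-U) ∕ (H-ζ) ∕ `0 ≤ ζ` ∕ `IsZetaAbsLeOne`.** [cite: King1986, (3.10) p.656; Balaban1989LargeFieldI, (0.3) p.176 (bookkeeping)] -/
theorem mgfForm_classWeightOfDatum₉_of_localBg {ι : Type*} (ϑ : Stage9Params F N) (hsel : ϑ.ppSel = ppSelIdOfRecord F ϑ.ν ϑ.τ9.M)
    (hU : LocalBgMeasurable F N ϑ.ν) (hζm : ZetaMeasurable F N ϑ.ζ) (hζ0 : ∀ p g k s Pl Ql RS U V', 0 ≤ ϑ.ζ p g k s Pl Ql RS U V')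
    (hζ1 : IsZetaAbsLeOne F N ϑ.ν ϑ.τ9.M ϑ.ζ) (D : FiniteEpsData F (SU N)) (hD : D.AvgMeasurable) (g₀ : ℕ → ℝ) (os : List (ULoop F))
    (pK : ℕ → B12.RunParams) (gK : ℕ → ℕ → ℝ) (kK : ℕ → ℕ) (T : ℕ → Finset ι)
    (e : ∀ K, ι → SeqOfRecord F ϑ.ν ϑ.τ9.M (gK K) (pK K).K (kK K)) :
    MGFForm 1 T (fun K => T4GenFunBounds.prodObs (D.scheme g₀) (pK K).K os)
      (fun K τ => classMeasureOfSlots F N ϑ.ν ϑ.τ9 (wOfRecord₉ F N ϑ) (pK K) (gK K) (Missing.boltzmann (F.P (pK K).K) ((g₀ (pK K).K)⁻¹ ^ 2))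
        (kK K) (e K τ))
      (fun K t τ => classWeightOfDatum₉ F N ϑ D g₀ os (pK K) (gK K) (kK K) t (e K τ)) :=
  mgfForm_classWeightOfDatum₉_of_ppSelId ϑ hsel (wOfRecord₉_nonneg ϑ hζ0) (wOfRecord₉_le_one ϑ hζ1)
    (fun p g k s' => measurable_wOfRecord_of_localBg hU ϑ.τ9.M ϑ.A₁ hζm p g k s')
    (fun p g k s => measurable_chiSeqOfRecord_of_localBg hU ϑ.τ9.M g p.K k s) D hD g₀ os pK gK kK T e

/-- **★ AT THE K0′ WITNESS `θ₀`** (`theta12OfRecord F N (zeta316OfRecord F N numerics7OfRecord₁₂ 1 1) Rz Zt`, any `Rz`, `Zt`): identity selector by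
`theta12OfRecord_ppSel` (`rfl`), ζ-laws by K0b (`zeta316OfRecord_nonneg`, `zetaMeasurable_zeta316OfRecord_of_localBg`) — ONE displayed hypothesis left, (H-U).
The Stage-9 part of `θ₀` supplies the steps; F3's ₁₂ record objects are these at `θ.toStage9Params` (`DressedSlotsOfRecord12`). [cite: King1986, (3.10) p.656; Balaban1988Convergent, (2.18) p.257 (bookkeeping)] -/
theorem classWeightOfDatum₉_eq_mgf_theta12OfRecord (hU : LocalBgMeasurable F N numerics7OfRecord₁₂)
    (Rz : (K : ℕ) → Sect2.Residual (F.P K) (MatA N)) (Zt : (K : ℕ) → TkResidualW F N (FluctV N) K)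
    (D : FiniteEpsData F (SU N)) (hD : D.AvgMeasurable) (g₀ : ℕ → ℝ) (os : List (ULoop F)) (p : B12.RunParams) (g : ℕ → ℝ) (k : ℕ) (t : ℝ)
    (s : SeqOfRecord F numerics7OfRecord₁₂ 1 g p.K k) :
    classWeightOfDatum₉ F N (theta12OfRecord F N (zeta316OfRecord F N numerics7OfRecord₁₂ 1 1) Rz Zt).toStage9Params D g₀ os p g k t s =
      mgf (T4GenFunBounds.prodObs (D.scheme g₀) p.K os)
        (classMeasureOfSlots F N numerics7OfRecord₁₂ (theta12OfRecord F N (zeta316OfRecord F N numerics7OfRecord₁₂ 1 1) Rz Zt).τ9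
          (wOfRecord₉ F N (theta12OfRecord F N (zeta316OfRecord F N numerics7OfRecord₁₂ 1 1) Rz Zt).toStage9Params) p g
          (Missing.boltzmann (F.P p.K) ((g₀ p.K)⁻¹ ^ 2)) k s) t :=
  classWeightOfDatum₉_eq_mgf_of_localBg _ (theta12OfRecord_ppSel F N _ Rz Zt) hU
    (zetaMeasurable_zeta316OfRecord_of_localBg hU 1 1) (zeta316OfRecord_nonneg 1) D hD g₀ os p g k t s

/-- **★ `MGFForm` AT THE K0′ WITNESS `θ₀`** — under (H-U) alone. [cite: King1986, (3.10) p.656; Balaban1989LargeFieldI, (0.3) p.176 (bookkeeping)] -/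
theorem mgfForm_classWeightOfDatum₉_theta12OfRecord {ι : Type*} (hU : LocalBgMeasurable F N numerics7OfRecord₁₂)
    (Rz : (K : ℕ) → Sect2.Residual (F.P K) (MatA N)) (Zt : (K : ℕ) → TkResidualW F N (FluctV N) K)
    (D : FiniteEpsData F (SU N)) (hD : D.AvgMeasurable) (g₀ : ℕ → ℝ) (os : List (ULoop F))
    (pK : ℕ → B12.RunParams) (gK : ℕ → ℕ → ℝ) (kK : ℕ → ℕ) (T : ℕ → Finset ι)
    (e : ∀ K, ι → SeqOfRecord F numerics7OfRecord₁₂ 1 (gK K) (pK K).K (kK K)) :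
    MGFForm 1 T (fun K => T4GenFunBounds.prodObs (D.scheme g₀) (pK K).K os)
      (fun K τ => classMeasureOfSlots F N numerics7OfRecord₁₂ (theta12OfRecord F N (zeta316OfRecord F N numerics7OfRecord₁₂ 1 1) Rz Zt).τ9
        (wOfRecord₉ F N (theta12OfRecord F N (zeta316OfRecord F N numerics7OfRecord₁₂ 1 1) Rz Zt).toStage9Params) (pK K) (gK K)
        (Missing.boltzmann (F.P (pK K).K) ((g₀ (pK K).K)⁻¹ ^ 2)) (kK K) (e K τ))
      (fun K t τ => classWeightOfDatum₉ F N (theta12OfRecord F N (zeta316OfRecord F N numerics7OfRecord₁₂ 1 1) Rz Zt).toStage9Params D g₀ os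
        (pK K) (gK K) (kK K) t (e K τ)) :=
  mgfForm_classWeightOfDatum₉_of_localBg _ (theta12OfRecord_ppSel F N _ Rz Zt) hU (zetaMeasurable_zeta316OfRecord_of_localBg hU 1 1)
    (zeta316OfRecord_nonneg 1) (isZetaAbsLeOne_zeta316OfRecord (A₁ := 1)) D hD g₀ os pK gK kK T e

/-! ## §4 The Kernel bridge for the generic chain files -/

/-- **THE SLOT MEASURES OF F3's DRESSED TOWER ARE A MATHLIB `Kernel`** (module A's `slotMeasure` at `wOfRecord₉ ϑ` and the Boltzmann reference start IS the
coercion of a kernel — `measurable_slotMeasure`; its level-0 value is the measure-valued START `ofReal(e^{−A(U)∕g₀²}) • δ_U` by `slotMeasure_zero`): the `K n s`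
of dag-n19-e's `…N19MGFFormKernelChainMeasureStart` hypotheses, for readers who prefer the abstract chain lemmas. [cite: Balaban1988Convergent, (2.18) p.257 (bookkeeping)] -/
theorem exists_kernel_eq_slotMeasure (ϑ : Stage9Params F N) {p : B12.RunParams} {g : ℕ → ℝ}
    (hwm : ∀ k s', Measurable fun z : GaugeField (F.P p.K) (k + 1) (SU N) × GaugeField (F.P p.K) k (SU N) => wOfRecord₉ F N ϑ p g k s' z.2 z.1)
    (hχm : ∀ k s, Measurable (chiSeqOfRecord F N ϑ.ν ϑ.τ9.M g p.K k s)) (g₀ : ℕ → ℝ) (k : ℕ) (s : SeqOfRecord F ϑ.ν ϑ.τ9.M g p.K k) :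
    ∃ κ : Kernel (GaugeField (F.P p.K) k (SU N)) (GaugeField (F.P p.K) 0 (SU N)),
      ∀ V, κ V = slotMeasure F N ϑ.ν ϑ.τ9 (wOfRecord₉ F N ϑ) p g (Missing.boltzmann (F.P p.K) ((g₀ p.K)⁻¹ ^ 2)) k s V :=
  ⟨⟨slotMeasure F N ϑ.ν ϑ.τ9 (wOfRecord₉ F N ϑ) p g (Missing.boltzmann (F.P p.K) ((g₀ p.K)⁻¹ ^ 2)) k s,
      measurable_slotMeasure hwm hχm (Missing.measurable_boltzmann RegularGaugeGroup.measurable_reTr (F.P p.K) _) k s⟩,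
    fun _ => rfl⟩

/-! ## §5 (v1.1) MGF form under PARTIAL SUMMATION into coarser classes — run B's term weights of the spine readings are FIBRE SUMS of run-(K+1)
class weights over the class projection (node U5d's truncation); a finite sum of MGFs of ONE observable is the MGF under the SUM measure, so `MGFForm`
passes to the coarse family with the fibre-sum class measures (generic over `DressedMGFForm.MGFForm`; then the F3 instance). Bookkeeping; the class
projection `π` and the fine∕coarse class lists are the READING's (parameters here). -/

section FiberSum

variable {ι ι' : Type*} [DecidableEq ι] {Ω : ℕ → Type*} [∀ K, MeasurableSpace (Ω K)] {Bo : ℝ} {T' : ℕ → Finset ι'}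
  {Fo : ∀ K, Ω K → ℝ} {ν' : ∀ K, ι' → Measure (Ω K)} {A' : ℕ → ℝ → ι' → ℝ}

/-- **`MGFForm` UNDER PARTIAL SUMMATION INTO COARSER CLASSES.**  If the fine family `A' K t τ'` (`τ' ∈ T' K`) is in MGF form with class measures `ν' K τ'`,
then for any class projection `π K : ι' → ι` and any coarse class lists `T K`, the fibre sums `A K t τ := Σ_{τ' ∈ T' K, π K τ' = τ} A' K t τ'` are in MGF
form with the SAME observable and bound and the fibre-sum measures `ν K τ := Σ_{τ' ∈ T' K, π K τ' = τ} ν' K τ'` (Mathlib `integral_finsetSum_measure`; an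
empty fibre gives `0 = mgf F 0 t`). [folklore] -/
theorem mgfForm_fiberSum (h : MGFForm Bo T' Fo ν' A') (π : ℕ → ι' → ι) (T : ℕ → Finset ι) :
    MGFForm Bo T Fo (fun K τ => ∑ τ' ∈ (T' K).filter (fun τ' => π K τ' = τ), ν' K τ')
      (fun K t τ => ∑ τ' ∈ (T' K).filter (fun τ' => π K τ' = τ), A' K t τ') where
  nonneg := h.nonneg
  meas := h.meas
  bound := h.bound
  finite K τ _ := by
    refine ⟨?_⟩
    rw [Measure.finsetSum_apply]
    exact ENNReal.sum_lt_top.2 fun τ' hτ' => by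
      haveI := h.finite K τ' (Finset.mem_filter.1 hτ').1
      exact measure_lt_top _ _
  repr K t τ _ := by
    have hint : ∀ τ' ∈ (T' K).filter (fun τ' => π K τ' = τ), Integrable (fun ω => Real.exp (t * Fo K ω)) (ν' K τ') := fun τ' hτ' => by
      haveI := h.finite K τ' (Finset.mem_filter.1 hτ').1
      exact T4GenFunBounds.integrable_exp_mul_of_bound (h.meas K).aemeasurable (ae_of_all _ (h.bound K)) t
    show _ = ∫ ω, Real.exp (t * Fo K ω) ∂(∑ τ' ∈ (T' K).filter (fun τ' => π K τ' = τ), ν' K τ')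
    rw [integral_finsetSum_measure hint]
    exact Finset.sum_congr rfl fun τ' hτ' => h.repr K t τ' (Finset.mem_filter.1 hτ').1

end FiberSum

/-- **★ F3 INSTANCE — `MGFForm` FOR FIBRE SUMS OF F3's DRESSED CLASS WEIGHTS (run B's shape)** at the identity selector: for fine keys `pK gK kK`, fine classes
`T' K` decoded by `e K`, any class projection `π K` into coarse classes `T K`, the fibre sums `Σ_{τ' ↦ τ} classWeightOfDatum₉ … t (e K τ')` are in MGF form
with observable `prodObs (D.scheme g₀) (pK K).K os`, `Bo = 1`, and class measures the fibre sums of `classMeasureOfSlots …` — what a spine-carrier reading's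
run-B term weights (run `K₀+K+1`'s sequences summed into run `K₀+K`'s classes) read. [cite: King1986, (3.10) p.656; Balaban1989LargeFieldI, (0.3) p.176 (bookkeeping)] -/
theorem mgfForm_classWeightOfDatum₉_fiberSum_of_ppSelId {ι ι' : Type*} [DecidableEq ι] (ϑ : Stage9Params F N)
    (hsel : ϑ.ppSel = ppSelIdOfRecord F ϑ.ν ϑ.τ9.M)
    (hw0 : ∀ p g k s' U V', 0 ≤ wOfRecord₉ F N ϑ p g k s' U V') (hw1 : ∀ p g k s' U V', wOfRecord₉ F N ϑ p g k s' U V' ≤ 1)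
    (hwm : ∀ (p : B12.RunParams) (g : ℕ → ℝ) k s',
      Measurable fun z : GaugeField (F.P p.K) (k + 1) (SU N) × GaugeField (F.P p.K) k (SU N) => wOfRecord₉ F N ϑ p g k s' z.2 z.1)
    (hχm : ∀ (p : B12.RunParams) (g : ℕ → ℝ) k s, Measurable (chiSeqOfRecord F N ϑ.ν ϑ.τ9.M g p.K k s))
    (D : FiniteEpsData F (SU N)) (hD : D.AvgMeasurable) (g₀ : ℕ → ℝ) (os : List (ULoop F))
    (pK : ℕ → B12.RunParams) (gK : ℕ → ℕ → ℝ) (kK : ℕ → ℕ) (T' : ℕ → Finset ι')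
    (e : ∀ K, ι' → SeqOfRecord F ϑ.ν ϑ.τ9.M (gK K) (pK K).K (kK K)) (π : ℕ → ι' → ι) (T : ℕ → Finset ι) :
    MGFForm 1 T (fun K => T4GenFunBounds.prodObs (D.scheme g₀) (pK K).K os)
      (fun K τ => ∑ τ' ∈ (T' K).filter (fun τ' => π K τ' = τ),
        classMeasureOfSlots F N ϑ.ν ϑ.τ9 (wOfRecord₉ F N ϑ) (pK K) (gK K) (Missing.boltzmann (F.P (pK K).K) ((g₀ (pK K).K)⁻¹ ^ 2)) (kK K) (e K τ'))
      (fun K t τ => ∑ τ' ∈ (T' K).filter (fun τ' => π K τ' = τ), classWeightOfDatum₉ F N ϑ D g₀ os (pK K) (gK K) (kK K) t (e K τ')) :=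
  mgfForm_fiberSum (mgfForm_classWeightOfDatum₉_of_ppSelId ϑ hsel hw0 hw1 hwm hχm D hD g₀ os pK gK kK T' e) π T

/-! ## §6 (v1.1) F3's displayed (e1) INTEGRABILITY, DISCHARGED at the identity selector: every dressed piece `χ_k(s)·slot^{t}_k(s)` is integrable
(module A part 2 §6), so `sum_classWeightOfDatum₉_eq_integral` holds with its `hint` SUPPLIED — the class weights sum to the integral of the dressed density
at EVERY level (the (e2) telescoping of F3's header stays NODE 00's) -/

open Literature.MathematicalPhysics.QuantumFieldTheory.Balaban1983to89.T4DressedR (exp_dressing_bounds)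

/-- **F3's (e1): THE DRESSED PIECES ARE INTEGRABLE AT EVERY LEVEL** — `χ_k(s)·dressedSlotsOfDatum₉ ϑ D g₀ os t … k s` is integrable over the level-`k` field
measure, for a Stage-9 tuple with the identity `p–p′` selector, under the displayed laws (`0 ≤ wOfRecord₉ ϑ ≤ 1`, jointly measurable; measurable `χ_k`)
and `D.AvgMeasurable` (F3 displays this integrability as the hypothesis `hint` «per (s2)»). [cite: Balaban1988Convergent, (2.18) p.257; King1986, (3.10) p.656 (bookkeeping)] -/
theorem integrable_chi_mul_dressedSlotsOfDatum₉_of_ppSelId (ϑ : Stage9Params F N) (hsel : ϑ.ppSel = ppSelIdOfRecord F ϑ.ν ϑ.τ9.M)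
    {p : B12.RunParams} {g : ℕ → ℝ}
    (hw0 : ∀ k s' U V', 0 ≤ wOfRecord₉ F N ϑ p g k s' U V') (hw1 : ∀ k s' U V', wOfRecord₉ F N ϑ p g k s' U V' ≤ 1)
    (hwm : ∀ k s', Measurable fun z : GaugeField (F.P p.K) (k + 1) (SU N) × GaugeField (F.P p.K) k (SU N) => wOfRecord₉ F N ϑ p g k s' z.2 z.1)
    (hχm : ∀ k s, Measurable (chiSeqOfRecord F N ϑ.ν ϑ.τ9.M g p.K k s)) (D : FiniteEpsData F (SU N)) (hD : D.AvgMeasurable)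
    (g₀ : ℕ → ℝ) (os : List (ULoop F)) (t : ℝ) (k : ℕ) (s : SeqOfRecord F ϑ.ν ϑ.τ9.M g p.K k) :
    Integrable (fun V => chiSeqOfRecord F N ϑ.ν ϑ.τ9.M g p.K k s V * dressedSlotsOfDatum₉ F N ϑ D g₀ os t p g k s V)
      (fieldMeasure (F.P p.K) k (SU N)) := by
  have hsel' : ∀ (k : ℕ) (s : SeqOfRecord F ϑ.ν ϑ.τ9.M g p.K (k + 1)), ϑ.ppSel p g (k + 1) s = s := fun k s => by
    rw [hsel]; rfl
  have hFb := T4GenFunBounds.abs_prodObs_le_one (D.scheme g₀) (fun K o U => D.abs_avgObs_le_one K o U) p.K os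
  exact integrable_chi_mul_texpAOfRecordFrom hsel' hw0 hw1 hwm hχm
    (Missing.measurable_boltzmann RegularGaugeGroup.measurable_reTr (F.P p.K) _) (fun U => (Missing.boltzmann_pos (F.P p.K) _ U).le)
    (Missing.integrable_boltzmann RegularGaugeGroup.measurable_reTr (F.P p.K) (sq_nonneg _)).lintegral_lt_top
    (Real.measurable_exp.comp ((T4GenFunBounds.measurable_prodObs (D.scheme g₀) (fun K o => D.measurable_avgObs hD K o) p.K os).const_mul t))
    (Real.exp_pos _) (Real.exp_pos _).le (fun U => (exp_dressing_bounds hFb t U).1) (fun U => (exp_dressing_bounds hFb t U).2)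
    (fun _ => rfl) k s

/-- **F3's `sum_classWeightOfDatum₉_eq_integral` WITH ITS HYPOTHESIS DISCHARGED**: at the identity selector, under the displayed laws, the class weights of
level `k` SUM to the integral of the dressed density at step `k` — `Σ_s classWeightOfDatum₉ ϑ D g₀ os p g k t s = ∫ dressedDensityOfDatum₉ ϑ D g₀ os t p g k`
— at EVERY level (F3 proved level 0 only, `sum_classWeightOfDatum₉_zero`). [cite: Balaban1988Convergent, (2.18) p.257; King1986, (3.10) p.656 (bookkeeping)] -/
theorem sum_classWeightOfDatum₉_eq_integral_of_ppSelId (ϑ : Stage9Params F N) (hsel : ϑ.ppSel = ppSelIdOfRecord F ϑ.ν ϑ.τ9.M)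
    {p : B12.RunParams} {g : ℕ → ℝ}
    (hw0 : ∀ k s' U V', 0 ≤ wOfRecord₉ F N ϑ p g k s' U V') (hw1 : ∀ k s' U V', wOfRecord₉ F N ϑ p g k s' U V' ≤ 1)
    (hwm : ∀ k s', Measurable fun z : GaugeField (F.P p.K) (k + 1) (SU N) × GaugeField (F.P p.K) k (SU N) => wOfRecord₉ F N ϑ p g k s' z.2 z.1)
    (hχm : ∀ k s, Measurable (chiSeqOfRecord F N ϑ.ν ϑ.τ9.M g p.K k s)) (D : FiniteEpsData F (SU N)) (hD : D.AvgMeasurable)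
    (g₀ : ℕ → ℝ) (os : List (ULoop F)) (t : ℝ) (k : ℕ) :
    ∑ s : SeqOfRecord F ϑ.ν ϑ.τ9.M g p.K k, classWeightOfDatum₉ F N ϑ D g₀ os p g k t s =
      ∫ V, dressedDensityOfDatum₉ F N ϑ D g₀ os t p g k V ∂fieldMeasure (F.P p.K) k (SU N) :=
  sum_classWeightOfDatum₉_eq_integral F N ϑ D g₀ os t p g k
    fun s => integrable_chi_mul_dressedSlotsOfDatum₉_of_ppSelId ϑ hsel hw0 hw1 hwm hχm D hD g₀ os t k s

/-! ## §7 (v1.1) AT THE LIVE SELECTOR OF RECORD — by ONE rewrite along dag-n19-c's `…N19MGFRoadLiveSelectorTower.classWeightOfDatum₉_ppSelLive_eq_ppSelId`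
(the dressed class weights at `ppSelLiveOfRecord` ARE the identity re-pin's, when the run's coupling history starts at the dressing's coupling `g 0 = g₀ p.K`):
the MGF identity and `MGFForm` hold at the K0′ ∕ K0‴ witnesses' LIVE selector with the SAME selector-free class measures -/

open Summit.QuantumFields.YangMills.BalabanUVNodes.N19MGFRoadLiveSelectorTower (classWeightOfDatum₉_ppSelLive_eq_ppSelId)

/-- **★ F3's DRESSED CLASS WEIGHT IS AN MGF — AT THE LIVE SELECTOR** `ϑ.ppSel = ppSelLiveOfRecord … E (wOfRecord₉ ϑ)` (any normalisation `E`), for `g 0 = g₀ p.K`,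
under the displayed laws and `D.AvgMeasurable`: same ν as at the identity selector (`classMeasureOfSlots` never reads the selector). One rewrite along dag-n19-c's
tower identity, then §2. [cite: King1986, (3.10) p.656; Balaban1989LargeFieldI, (0.3) p.176 and p.177 (bookkeeping)] -/
theorem classWeightOfDatum₉_eq_mgf_of_ppSelLive (ϑ : Stage9Params F N) (E : B12.RunParams → ℝ)
    (hsel : ϑ.ppSel = ppSelLiveOfRecord F N ϑ.ν ϑ.τ9 E (wOfRecord₉ F N ϑ)) {p : B12.RunParams} {g : ℕ → ℝ} {g₀ : ℕ → ℝ} (hg : g 0 = g₀ p.K)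
    (hw0 : ∀ k s' U V', 0 ≤ wOfRecord₉ F N ϑ p g k s' U V')
    (hwm : ∀ k s', Measurable fun z : GaugeField (F.P p.K) (k + 1) (SU N) × GaugeField (F.P p.K) k (SU N) => wOfRecord₉ F N ϑ p g k s' z.2 z.1)
    (hχm : ∀ k s, Measurable (chiSeqOfRecord F N ϑ.ν ϑ.τ9.M g p.K k s)) (D : FiniteEpsData F (SU N)) (hD : D.AvgMeasurable)
    (os : List (ULoop F)) (k : ℕ) (t : ℝ) (s : SeqOfRecord F ϑ.ν ϑ.τ9.M g p.K k) :
    classWeightOfDatum₉ F N ϑ D g₀ os p g k t s =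
      mgf (T4GenFunBounds.prodObs (D.scheme g₀) p.K os)
        (classMeasureOfSlots F N ϑ.ν ϑ.τ9 (wOfRecord₉ F N ϑ) p g (Missing.boltzmann (F.P p.K) ((g₀ p.K)⁻¹ ^ 2)) k s) t := by
  rw [classWeightOfDatum₉_ppSelLive_eq_ppSelId F N ϑ D g₀ os p g E hsel hg hD hw0 hwm hχm k t s]
  exact classWeightOfDatum₉_eq_mgf_of_ppSelId { ϑ with ppSel := ppSelIdOfRecord F ϑ.ν ϑ.τ9.M } rfl hw0 hwm hχm D hD g₀ os k t s

/-- **★ `MGFForm` AT THE LIVE SELECTOR** for any run-indexed keys with `gK K 0 = g₀ (pK K).K` and any decoding (`Bo = 1`; class measures as at the identity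
selector). [cite: King1986, (3.10) p.656; Balaban1989LargeFieldI, (0.3) p.176 (bookkeeping)] -/
theorem mgfForm_classWeightOfDatum₉_of_ppSelLive {ι : Type*} (ϑ : Stage9Params F N) (E : B12.RunParams → ℝ)
    (hsel : ϑ.ppSel = ppSelLiveOfRecord F N ϑ.ν ϑ.τ9 E (wOfRecord₉ F N ϑ))
    (hw0 : ∀ p g k s' U V', 0 ≤ wOfRecord₉ F N ϑ p g k s' U V') (hw1 : ∀ p g k s' U V', wOfRecord₉ F N ϑ p g k s' U V' ≤ 1)
    (hwm : ∀ (p : B12.RunParams) (g : ℕ → ℝ) k s',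
      Measurable fun z : GaugeField (F.P p.K) (k + 1) (SU N) × GaugeField (F.P p.K) k (SU N) => wOfRecord₉ F N ϑ p g k s' z.2 z.1)
    (hχm : ∀ (p : B12.RunParams) (g : ℕ → ℝ) k s, Measurable (chiSeqOfRecord F N ϑ.ν ϑ.τ9.M g p.K k s))
    (D : FiniteEpsData F (SU N)) (hD : D.AvgMeasurable) (g₀ : ℕ → ℝ) (os : List (ULoop F))
    (pK : ℕ → B12.RunParams) (gK : ℕ → ℕ → ℝ) (hg : ∀ K, gK K 0 = g₀ (pK K).K) (kK : ℕ → ℕ) (T : ℕ → Finset ι)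
    (e : ∀ K, ι → SeqOfRecord F ϑ.ν ϑ.τ9.M (gK K) (pK K).K (kK K)) :
    MGFForm 1 T (fun K => T4GenFunBounds.prodObs (D.scheme g₀) (pK K).K os)
      (fun K τ => classMeasureOfSlots F N ϑ.ν ϑ.τ9 (wOfRecord₉ F N ϑ) (pK K) (gK K) (Missing.boltzmann (F.P (pK K).K) ((g₀ (pK K).K)⁻¹ ^ 2))
        (kK K) (e K τ))
      (fun K t τ => classWeightOfDatum₉ F N ϑ D g₀ os (pK K) (gK K) (kK K) t (e K τ)) where
  nonneg := zero_le_one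
  meas K := T4GenFunBounds.measurable_prodObs (D.scheme g₀) (fun K o => D.measurable_avgObs hD K o) (pK K).K os
  bound K ω := T4GenFunBounds.abs_prodObs_le_one (D.scheme g₀) (fun K o U => D.abs_avgObs_le_one K o U) (pK K).K os ω
  finite K τ _ := isFiniteMeasure_classMeasure_dressedSlotsOfDatum₉ ϑ (hw1 _ _) (hwm _ _) (hχm _ _) g₀ (kK K) (e K τ)
  repr K t τ _ := classWeightOfDatum₉_eq_mgf_of_ppSelLive ϑ E hsel (hg K) (hw0 _ _) (hwm _ _) (hχm _ _) D hD os (kK K) t (e K τ)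

/-- **★ AT THE RE-PINNED K0′ WITNESS `θ₀ˡⁱᵛᵉ = theta12LiveOfRecord F N (zeta316OfRecord …) Rz Zt`** (director-ym №114 (α); selector by
`theta12LiveOfRecord_ppSel`, ζ-laws by K0b): for `g 0 = g₀ p.K`, the MGF identity with ONE displayed hypothesis left, (H-U).
[cite: King1986, (3.10) p.656; Balaban1989LargeFieldI, (0.3) p.176 and p.177 (bookkeeping)] -/
theorem classWeightOfDatum₉_eq_mgf_theta12LiveOfRecord (hU : LocalBgMeasurable F N numerics7OfRecord₁₂)
    (Rz : (K : ℕ) → Sect2.Residual (F.P K) (MatA N)) (Zt : (K : ℕ) → TkResidualW F N (FluctV N) K)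
    (D : FiniteEpsData F (SU N)) (hD : D.AvgMeasurable) (g₀ : ℕ → ℝ) (os : List (ULoop F)) (p : B12.RunParams) (g : ℕ → ℝ) (hg : g 0 = g₀ p.K)
    (k : ℕ) (t : ℝ) (s : SeqOfRecord F numerics7OfRecord₁₂ 1 g p.K k) :
    classWeightOfDatum₉ F N (theta12LiveOfRecord F N (zeta316OfRecord F N numerics7OfRecord₁₂ 1 1) Rz Zt).toStage9Params D g₀ os p g k t s =
      mgf (T4GenFunBounds.prodObs (D.scheme g₀) p.K os)
        (classMeasureOfSlots F N numerics7OfRecord₁₂ (theta12OfRecord F N (zeta316OfRecord F N numerics7OfRecord₁₂ 1 1) Rz Zt).τ9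
          (wOfRecord₉ F N (theta12OfRecord F N (zeta316OfRecord F N numerics7OfRecord₁₂ 1 1) Rz Zt).toStage9Params) p g
          (Missing.boltzmann (F.P p.K) ((g₀ p.K)⁻¹ ^ 2)) k s) t :=
  classWeightOfDatum₉_eq_mgf_of_ppSelLive _ _ (theta12LiveOfRecord_ppSel F N _ Rz Zt) hg
    (wOfRecord₉_nonneg _ (zeta316OfRecord_nonneg 1) p g)
    (fun k s' => measurable_wOfRecord_of_localBg hU _ _ (zetaMeasurable_zeta316OfRecord_of_localBg hU 1 1) p g k s')
    (fun k s => measurable_chiSeqOfRecord_of_localBg hU _ g p.K k s) D hD os k t s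

/-- **★ AT THE K0‴ WITNESS FAMILY `θ₁₃ = theta13LiveOfFamily F N ε₀ (zeta316OfRecord …) Rz Zt`** (Record 13; `theta13LiveOfRecord F N` is the member at
`eps0OfRecord₁₃`, `RzOfRecord`, `ZtOfRecord` by `theta13LiveOfRecord_eq`): selector by `theta13LiveOfFamily_ppSel`, ζ-laws by K0b; for `g 0 = g₀ p.K`, the
MGF identity with ONE displayed hypothesis left, (H-U) at the family's numerics. [cite: King1986, (3.10) p.656; Balaban1989LargeFieldI, (0.3) p.176 and p.177 (bookkeeping)] -/
theorem classWeightOfDatum₉_eq_mgf_theta13LiveOfFamily (ε₀ : ℝ) (hU : LocalBgMeasurable F N (numerics7OfFamily ε₀))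
    (Rz : (K : ℕ) → Sect2.Residual (F.P K) (MatA N)) (Zt : (K : ℕ) → TkResidualW F N (FluctV N) K)
    (D : FiniteEpsData F (SU N)) (hD : D.AvgMeasurable) (g₀ : ℕ → ℝ) (os : List (ULoop F)) (p : B12.RunParams) (g : ℕ → ℝ) (hg : g 0 = g₀ p.K)
    (k : ℕ) (t : ℝ) (s : SeqOfRecord F (numerics7OfFamily ε₀) 1 g p.K k) :
    classWeightOfDatum₉ F N (theta13LiveOfFamily F N ε₀ (zeta316OfRecord F N (numerics7OfFamily ε₀) 1 1) Rz Zt).toStage9Params D g₀ os p g k t s =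
      mgf (T4GenFunBounds.prodObs (D.scheme g₀) p.K os)
        (classMeasureOfSlots F N (numerics7OfFamily ε₀) (theta13LiveOfFamily F N ε₀ (zeta316OfRecord F N (numerics7OfFamily ε₀) 1 1) Rz Zt).τ9
          (wOfRecord₉ F N (theta13LiveOfFamily F N ε₀ (zeta316OfRecord F N (numerics7OfFamily ε₀) 1 1) Rz Zt).toStage9Params) p g
          (Missing.boltzmann (F.P p.K) ((g₀ p.K)⁻¹ ^ 2)) k s) t :=
  classWeightOfDatum₉_eq_mgf_of_ppSelLive _ _ (theta13LiveOfFamily_ppSel F N ε₀ _ Rz Zt) hg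
    (wOfRecord₉_nonneg _ (zeta316OfRecord_nonneg 1) p g)
    (fun k s' => measurable_wOfRecord_of_localBg hU _ _ (zetaMeasurable_zeta316OfRecord_of_localBg hU 1 1) p g k s')
    (fun k s => measurable_chiSeqOfRecord_of_localBg hU _ g p.K k s) D hD os k t s

end Summit.QuantumFields.YangMills.BalabanUVNodes.N19MGFFormAtRecord

end
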